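import Literature.NumberTheory.Sieve.HeathBrownCubicLeadingB
import Literature.NumberTheory.Sieve.HeathBrownCubicLemma71A
import Literature.NumberTheory.Sieve.HeathBrownCubicTypeIHolds
import Literature.NumberTheory.Sieve.HeathBrownCubicApproxUB
import Literature.NumberTheory.Sieve.HeathBrownCubicTypeIIWeightBounds
import Literature.NumberTheory.Sieve.HeathBrownCubicIdealMoebius
import HarnessLib

/-!
# Heath-Brown's Lemma 3.9, the `𝒜`-side (10.4), I: the pair sums `∑_{R,J} c_{R,J} #𝒜^(K)_{RJ}` and Lemma 3.2

Pure-proof file (no definitions, no named facts) in the decomposition of **parity.S18**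
(`Literature.NumberTheory.Sieve.setOf_prime_cube_add_two_mul_cube_infinite`) along D. R. Heath-Brown,
*Primes represented by `x³ + 2y³`*, Acta Math. 186 (2001), 1–84, towards the named fact
`HeathBrown2001_lemma_3_9` (`HeathBrownCubicTypeII`), which `HeathBrownCubicLeadingB` reduces to the
`𝒜`-side display (10.4) (`HeathBrown2001_lemma_3_9_of_display_10_4`). The proof of (10.4) (§10,
pp. 60–64) rewrites the leading part `U_e(𝒜) = ∑_{RS ∈ 𝒜^(K)} c_R e_S`, `e_S` from (3.12), as

  `U_e(𝒜) = ∑_{R,J} c_{R,J} #𝒜^(K)_{RJ} + (error)`, `c_{R,J} = c_R w'(3X³/N(R)) μ(J) log(L/N(J)) / (M(ξ log X)^{n+1})`,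

observes that "all prime ideal factors of `R` have `N(P) ≥ X^τ`, while `N(J) ≤ L = X^{τ/2}`. Thus `R` and
`J` are coprime, whence `RJ` may be assumed to be square-free. We also have `N(RJ) ≪ X^{2−τ/2}` … We are
therefore in a position to apply Lemma 3.2" (pp. 61–62), and obtains the main term
`(6η²X²/π²) ∑_{R,J : RJ ∈ 𝒯r} c_{R,J} ρ₂(RJ)/N(RJ) = (6η²X²/π²) ∑_R (…) ρ₂(R)/N(R) · Σ₁`. This file PROVES
the generic tools for that passage, for arbitrary weights `α_R`, `β_J` with the relevant supports:

* `sum_divisorPairs_mul_sum_eq`, **`bilin_sum_divisors_eq`** — the exchange of summations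
  `∑_I ∑_{RS = I} α_R ∑_{J ∣ S, N(J) < L} β_J = ∑_{R,J} α_R β_J #{I : RJ ∣ I}` (for `R` fixed the cofactor
  `S` is unique, and `J ∣ S ⟺ RJ ∣ I`);
* Lemma 3.1 consequences: `isCoprime_of_isRough_of_absNorm_lt` (a `z`-rough `R` is coprime to every
  `J ≠ 0` of norm `< z`), `squarefree_absNorm_of_dvd_pairIdeal` and
  **`countA_eq_zero_of_not_squarefree_absNorm`** (`#𝒜^(K)_D = 0` for square-free `D ∉ 𝒯r`),
  `squarefree_mul_of_rough_of_small`, `coprime_absNorm_of_rough_of_small`, `squarefree_absNorm_mul_iff`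
  (`RJ ∈ 𝒯r ⟺ J ∈ 𝒯r`), `rho₂_mul_of_coprime`, `rho₂_nonneg_le_one`, **`mul_injOn_rough_small`**
  (`(R, J) ↦ RJ` is injective);
* **`sum_pairs_abs_sub_main_le`** (the core), `sum_pairs_main_eq`, **`abs_sum_pairs_countA_sub_le`**,
  **`sum_pairs_countA_le`** — Lemma 3.2 for pair sums:
  `|∑_{R,J} α_Rβ_J#𝒜^(K)_{RJ} − X_𝒜(∑_R α_Rρ₂(R)/N(R))(∑_{J∈𝒯r}β_Jρ₂(J)/N(J))| ≤ AB·∑_{N(D)≤R_maxL, D∈𝒯r}|#𝒜^(K)_D − X_𝒜ρ₂(D)/N(D)|`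
  and the corresponding upper bound for non-negative weights (`X_𝒜 = 6η²X²/π²`, `sizeA`);
* **`exists_typeI_squarefree_sum_le`** — Lemma 3.2 summed over `D ∈ 𝒯r`, `N(D) ≤ B`
  (`HeathBrown2001_typeI_A_holds` through `exists_typeI_dyadic`, plus the term `D = (1)`):
  `≪ X(1 + log X) + (B + X√B + X^{3/2})(log X)^{k+1}` for `X ≥ 3`, `1 ≤ B ≤ X³`, `η` in the range (2.1).

## References

* D. R. Heath-Brown, *Primes represented by `x³ + 2y³`*, Acta Math. 186 (2001), 1–84: Lemma 3.1, Lemma 3.2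
  (p. 11), §10 pp. 61–62. [cite: HeathBrownActa2001, §10 pp. 61–62]

## Mathlib / tree search

Mathlib: `Finset.sum_bij`, `Finset.sum_sigma'`, `Finset.sum_product'`, `Finset.sum_comm`,
`Finset.card_filter`, `Finset.sum_filter`, `Finset.sum_image`, `Finset.sum_mul_sum`,
`Ideal.coprime_of_no_prime_ge`, `IsCoprime.dvd_of_dvd_mul_right`, `IsCoprime.isRelPrime`,
`squarefree_mul_iff`, `Nat.squarefree_mul`, `mul_left_cancel₀`, `Ideal.absNorm_eq_one_iff`. Tree:
`HeathBrownCubicTypeII` (`divisorPairs`, `mem_divisorPairs_iff`, `idealDivisors`, `mem_idealDivisors_iff`,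
`idealMoebius`), `HeathBrownCubicSieveSetup` (`idealsLE`, `countA`, `APairs`, `APairs_one`, `boxPairs`,
`pairIdeal`, `IsRough`, `rho₂`, `primeFactorsFinset`), `HeathBrownCubicFLSequencesA` (`NormSimple`,
`normSimple_pairIdeal`, `isCoprime_of_mem_boxPairs`, `normSimple_of_squarefree_absNorm`,
`NormSimple.exists_prime_dvd_of_dvd_absNorm`, `ne_bot_of_dvd_ne_bot`, `sizeA`, `sizeA_nonneg`),
`HeathBrownCubicSieveDecomposition` (`pairIdeal_ne_bot_of_mem_boxPairs`), `HeathBrownCubicApproxUB`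
(`squarefree_absNorm_of_factors`), `HeathBrownCubicTypeIMoebius` (`squarefree_of_squarefree_absNorm`),
`HeathBrownCubicIdealMoebius` (`primeFactorsFinset_mul_of_coprime`), `HeathBrownCubicLemma71A`
(`exists_typeI_dyadic`, `countA_top_sub_eq`), `HeathBrownCubicTypeIHolds` (`HeathBrown2001_typeI_A_holds`),
`HeathBrownCubicFLRemaindersA` (`exists_abs_countA_one_sub_sizeA_le`). Searched for an existing
rearrangement of `bilin … eWeight` into pair sums (`lean search 'divisorPairs.*idealDivisors|countA.*mul'`):
none (`HeathBrownCubicLeadingB.bilin_normWindow_dWeight_eq` is the `ℬ`-side analogue over prime tuples).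
-/

noncomputable section

open Polynomial NumberField Finset Filter Topology

namespace Literature.NumberTheory.Sieve.CubicSieve

open LFunctions.CubeRootTwoField CubicPrimes

/-! ### The exchange of summations: `∑_I ∑_{RS=I} α_R ∑_{J∣S, N(J)<L} β_J = ∑_{R,J} α_R β_J #{I : RJ ∣ I}` -/

section Exchange

variable {ι : Type*}

open scoped Classical in
/-- For one nonzero ideal `I`: the pairs `(R, S)` with `RS = I` together with the divisors `J ∣ S` of
norm `< L` correspond to the pairs `(R, J)` with `RJ ∣ I` (given `R`, the cofactor `S` is unique, and
`J ∣ S ⟺ RJ ∣ RS`), so `∑_{RS = I} α_R ∑_{J ∣ S, N(J) < L} β_J = ∑_{N(R) ≤ N_max, N(J) < L, RJ ∣ I} α_R β_J`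
for any `N_max ≥ N(I)`. [cite: HeathBrownActa2001, §10 p. 62] -/
theorem sum_divisorPairs_mul_sum_eq {I : Ideal (𝓞 K)} (hI : I ≠ ⊥) (α β : Ideal (𝓞 K) → ℝ) (L : ℝ)
    {Nmax : ℕ} (hN : Ideal.absNorm I ≤ Nmax) :
    ∑ RS ∈ divisorPairs I, α RS.1 *
        ∑ J ∈ (idealDivisors RS.2).filter (fun J => (Ideal.absNorm J : ℝ) < L), β J =
      ∑ RJ ∈ (idealsLE Nmax ×ˢ (idealsLE ⌊L⌋₊).filter (fun J => (Ideal.absNorm J : ℝ) < L)).filter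
          (fun RJ => RJ.1 * RJ.2 ∣ I), α RJ.1 * β RJ.2 := by
  have hI0 : (I : Ideal (𝓞 K)) ≠ 0 := by rwa [Ne, Ideal.zero_eq_bot]
  have hNI : 0 < Ideal.absNorm I := Nat.pos_of_ne_zero fun h => hI (Ideal.absNorm_eq_zero_iff.mp h)
  simp_rw [Finset.mul_sum]
  rw [Finset.sum_sigma']
  refine Finset.sum_bij (fun x _ => (x.1.1, x.2)) ?_ ?_ ?_ ?_
  · rintro ⟨⟨R, S⟩, J⟩ hx
    rw [Finset.mem_sigma] at hx
    obtain ⟨hRS, hJ⟩ := hx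
    rw [mem_divisorPairs_iff hI] at hRS
    have hS0 : S ≠ ⊥ := fun h => hI (by rw [← hRS, h, Ideal.mul_bot])
    rw [mem_filter, mem_idealDivisors_iff hS0] at hJ
    simp only [mem_filter, mem_product, mem_idealsLE]
    refine ⟨⟨?_, Nat.le_floor hJ.2.le, hJ.2⟩, ?_⟩
    · refine le_trans (Nat.le_of_dvd hNI ?_) hN
      exact Ideal.absNorm_dvd_absNorm_of_le (Ideal.le_of_dvd ⟨S, hRS.symm⟩)
    · rw [← hRS]
      exact mul_dvd_mul_left R hJ.1
  · rintro ⟨⟨R, S⟩, J⟩ hx ⟨⟨R', S'⟩, J'⟩ hx' h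
    simp only [Prod.mk.injEq] at h
    obtain ⟨rfl, rfl⟩ := h
    rw [Finset.mem_sigma] at hx hx'
    have h1 := (mem_divisorPairs_iff hI).mp hx.1
    have h2 := (mem_divisorPairs_iff hI).mp hx'.1
    simp only at h1 h2
    have hR0 : R ≠ 0 := fun h => hI0 (by rw [← h1, h, zero_mul])
    have hSS : S = S' := mul_left_cancel₀ hR0 (h1.trans h2.symm)
    subst hSS
    rfl
  · rintro ⟨R, J⟩ hRJ
    simp only [mem_filter, mem_product, mem_idealsLE] at hRJ
    obtain ⟨⟨-, -, hJL⟩, T, hT⟩ := hRJ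
    refine ⟨⟨(R, J * T), J⟩, ?_, rfl⟩
    have hRS : R * (J * T) = I := by rw [← mul_assoc, ← hT]
    have hS0 : J * T ≠ ⊥ := fun h => hI (by rw [← hRS, h, Ideal.mul_bot])
    rw [Finset.mem_sigma, mem_divisorPairs_iff hI, mem_filter, mem_idealDivisors_iff hS0]
    exact ⟨hRS, ⟨T, rfl⟩, hJL⟩
  · rintro ⟨⟨R, S⟩, J⟩ _
    rfl

open scoped Classical in
/-- **The exchange of summations behind `U_e(𝒜) = ∑_{R,J} c_{R,J} #𝒜^(K)_{RJ}`** (p. 62): for a finite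
family of nonzero ideals `I_i` of norm `≤ N_max` and arbitrary weights `α`, `β`,
`∑_i ∑_{RS = I_i} α_R ∑_{J ∣ S, N(J) < L} β_J = ∑_{N(R) ≤ N_max} ∑_{N(J) < L} α_R β_J #{i : RJ ∣ I_i}`.
[cite: HeathBrownActa2001, §10 p. 62] -/
theorem bilin_sum_divisors_eq (E : Finset ι) (I : ι → Ideal (𝓞 K)) (hI : ∀ i ∈ E, I i ≠ ⊥)
    (α β : Ideal (𝓞 K) → ℝ) (L : ℝ) {Nmax : ℕ} (hN : ∀ i ∈ E, Ideal.absNorm (I i) ≤ Nmax) :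
    ∑ i ∈ E, ∑ RS ∈ divisorPairs (I i), α RS.1 *
        ∑ J ∈ (idealDivisors RS.2).filter (fun J => (Ideal.absNorm J : ℝ) < L), β J =
      ∑ R ∈ idealsLE Nmax, ∑ J ∈ (idealsLE ⌊L⌋₊).filter (fun J => (Ideal.absNorm J : ℝ) < L),
        α R * β J * #{i ∈ E | R * J ∣ I i} := by
  rw [Finset.sum_congr rfl fun i hi => sum_divisorPairs_mul_sum_eq (hI i hi) α β L (hN i hi)]
  rw [← Finset.sum_product']
  simp_rw [Finset.card_filter, Nat.cast_sum, Nat.cast_ite, Nat.cast_one, Nat.cast_zero,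
    Finset.mul_sum, mul_ite, mul_one, mul_zero]
  rw [Finset.sum_comm]
  refine Finset.sum_congr rfl fun i _ => ?_
  rw [Finset.sum_filter]

end Exchange

/-! ### Lemma 3.1 consequences: coprimality, square-free norms, vanishing of `#𝒜^(K)_{RJ}` -/

section LemmaThreeOne

/-- A `z`-rough ideal is coprime to every nonzero ideal of norm `< z` (a common prime factor would have
norm `≥ z` and `≤ N(J) < z`). [cite: HeathBrownActa2001, §10 p. 61] -/
theorem isCoprime_of_isRough_of_absNorm_lt {z : ℝ} {R J : Ideal (𝓞 K)} (hR : IsRough z R)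
    (hJ0 : J ≠ ⊥) (hJ : (Ideal.absNorm J : ℝ) < z) : IsCoprime R J := by
  refine Ideal.coprime_of_no_prime_ge fun P hRP hJP hP => ?_
  have hPJ : P ∣ J := Ideal.dvd_iff_le.mpr hJP
  have hPR : P ∣ R := Ideal.dvd_iff_le.mpr hRP
  have hNJ : 0 < Ideal.absNorm J :=
    Nat.pos_of_ne_zero fun h => hJ0 (Ideal.absNorm_eq_zero_iff.mp h)
  have h1 : z ≤ (Ideal.absNorm P : ℝ) := hR hP hPR
  have h2 : Ideal.absNorm P ≤ Ideal.absNorm J :=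
    Nat.le_of_dvd hNJ (Ideal.absNorm_dvd_absNorm_of_le hJP)
  have h2' : (Ideal.absNorm P : ℝ) ≤ Ideal.absNorm J := by exact_mod_cast h2
  linarith

/-- `μ(J) ≠ 0` forces `J` to be square-free. [folklore] -/
theorem squarefree_of_idealMoebius_ne_zero {J : Ideal (𝓞 K)} (h : idealMoebius J ≠ 0) :
    Squarefree J := by
  by_contra hJ
  exact h (by rw [idealMoebius, if_neg hJ])

/-- **Lemma 3.1 for divisors**: a square-free ideal dividing a member `(x + y·2^{1/3})` of `𝒜^(K)` has
square-free norm ("if a square-free ideal `R` divides an element of `𝒜^(K)`, then `N(R)` must be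
square-free", p. 11). [cite: HeathBrownActa2001, Lemma 3.1] -/
theorem squarefree_absNorm_of_dvd_pairIdeal {X η : ℝ} (hX : 0 ≤ X) {xy : ℕ × ℕ}
    (hxy : xy ∈ boxPairs X η) {D : Ideal (𝓞 K)} (hD : Squarefree D) (hDI : D ∣ pairIdeal xy) :
    Squarefree (Ideal.absNorm D) := by
  have hI0 : pairIdeal xy ≠ ⊥ := pairIdeal_ne_bot_of_mem_boxPairs hX xy hxy
  have hNS : NormSimple D := (normSimple_pairIdeal (isCoprime_of_mem_boxPairs hxy)).of_dvd hDI
  have hD0 : D ≠ ⊥ := ne_bot_of_dvd_ne_bot hI0 hDI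
  exact squarefree_absNorm_of_factors hD0 hD
    (fun P hP hPD => (hNS hP (ne_bot_of_dvd_ne_bot hD0 hPD) hPD).1)
    (fun P P' hP hP' hPD hP'D hN => (hNS hP (ne_bot_of_dvd_ne_bot hD0 hPD) hPD).2 hP' hP'D hN)

open scoped Classical in
/-- Hence `#𝒜^(K)_D = 0` for a square-free ideal `D` whose norm is not square-free ("By Lemma 3.1 we have
`#𝒜^(K)_R = 0` unless `R ∈ 𝒯r`", p. 33). [cite: HeathBrownActa2001, Lemma 3.1] -/
theorem countA_eq_zero_of_not_squarefree_absNorm {X η : ℝ} (hX : 0 ≤ X) {D : Ideal (𝓞 K)}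
    (hD : Squarefree D) (hN : ¬Squarefree (Ideal.absNorm D)) : countA X η D = 0 := by
  rw [countA, Finset.card_eq_zero, Finset.eq_empty_iff_forall_notMem]
  intro xy hxy
  rw [mem_APairs_iff] at hxy
  exact hN (squarefree_absNorm_of_dvd_pairIdeal hX hxy.1 hD hxy.2)

/-- For `R` of square-free norm, `z`-rough, and `J` square-free of norm `< z`: `RJ` is square-free.
[cite: HeathBrownActa2001, §10 p. 61] -/
theorem squarefree_mul_of_rough_of_small {z : ℝ} {R J : Ideal (𝓞 K)} (hR : Squarefree (Ideal.absNorm R))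
    (hRz : IsRough z R) (hJ : Squarefree J) (hJz : (Ideal.absNorm J : ℝ) < z) :
    Squarefree (R * J) := by
  have hJ0 : J ≠ ⊥ := by rw [Ne, ← Ideal.zero_eq_bot]; exact hJ.ne_zero
  have hcop := isCoprime_of_isRough_of_absNorm_lt hRz hJ0 hJz
  exact squarefree_mul_iff.mpr ⟨hcop.isRelPrime, squarefree_of_squarefree_absNorm hR, hJ⟩

/-- The norm of a `z`-rough ideal `R` of square-free norm is coprime to the norm of any `J` of
square-free norm `< z`: a common prime `p` would be the norm of a prime factor of `R` (so `p ≥ z`) and of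
one of `J` (so `p ≤ N(J) < z`). [cite: HeathBrownActa2001, §10 p. 61] -/
theorem coprime_absNorm_of_rough_of_small {z : ℝ} {R J : Ideal (𝓞 K)} (hR : Squarefree (Ideal.absNorm R))
    (hRz : IsRough z R) (hJ : Squarefree (Ideal.absNorm J)) (hJz : (Ideal.absNorm J : ℝ) < z) :
    (Ideal.absNorm R).Coprime (Ideal.absNorm J) := by
  have hR0 : R ≠ ⊥ := fun h => by rw [h, Ideal.absNorm_bot] at hR; exact not_squarefree_zero hR
  have hJ0 : J ≠ ⊥ := fun h => by rw [h, Ideal.absNorm_bot] at hJ; exact not_squarefree_zero hJ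
  rw [Nat.coprime_iff_gcd_eq_one]
  by_contra hg
  obtain ⟨p, hp, hpg⟩ := Nat.exists_prime_and_dvd hg
  have hpR : p ∣ Ideal.absNorm R := hpg.trans (Nat.gcd_dvd_left _ _)
  have hpJ : p ∣ Ideal.absNorm J := hpg.trans (Nat.gcd_dvd_right _ _)
  obtain ⟨P, hP, -, hPR, hNP⟩ :=
    (normSimple_of_squarefree_absNorm hR).exists_prime_dvd_of_dvd_absNorm hR0 hp hpR
  have h1 : z ≤ (Ideal.absNorm P : ℝ) := hRz hP hPR
  have hNJ : 0 < Ideal.absNorm J := Nat.pos_of_ne_zero (Squarefree.ne_zero hJ)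
  have h2 : p ≤ Ideal.absNorm J := Nat.le_of_dvd hNJ hpJ
  have h2' : (p : ℝ) ≤ Ideal.absNorm J := by exact_mod_cast h2
  rw [hNP] at h1
  linarith

/-- For `R` of square-free norm, `z`-rough, and `J` square-free of norm `< z`:
`N(RJ)` is square-free iff `N(J)` is. [cite: HeathBrownActa2001, §10 p. 62] -/
theorem squarefree_absNorm_mul_iff {z : ℝ} {R J : Ideal (𝓞 K)} (hR : Squarefree (Ideal.absNorm R))
    (hRz : IsRough z R) (hJz : (Ideal.absNorm J : ℝ) < z) :
    Squarefree (Ideal.absNorm (R * J)) ↔ Squarefree (Ideal.absNorm J) := by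
  rw [map_mul]
  constructor
  · exact fun h => Squarefree.of_mul_right h
  · intro hJ
    exact (Nat.squarefree_mul (coprime_absNorm_of_rough_of_small hR hRz hJ hJz)).mpr ⟨hR, hJ⟩

/-- `ρ₂(RJ) = ρ₂(R)ρ₂(J)` for coprime nonzero `R`, `J` (`ρ₂` multiplicative, Lemma 3.2).
[cite: HeathBrownActa2001, Lemma 3.2] -/
theorem rho₂_mul_of_coprime {R J : Ideal (𝓞 K)} (hR0 : R ≠ ⊥) (hJ0 : J ≠ ⊥) (h : IsCoprime R J) :
    rho₂ (R * J) = rho₂ R * rho₂ J := by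
  obtain ⟨hunion, hdisj⟩ :=
    primeFactorsFinset_mul_of_coprime hR0 hJ0 (Ideal.isCoprime_iff_sup_eq.mp h)
  rw [rho₂, hunion, Finset.prod_union hdisj, rho₂, rho₂]

/-- `0 ≤ ρ₂(R) ≤ 1`. [folklore] -/
theorem rho₂_nonneg_le_one (R : Ideal (𝓞 K)) : 0 ≤ rho₂ R ∧ rho₂ R ≤ 1 := by
  rw [rho₂]
  refine ⟨prod_nonneg fun P _ => by positivity, prod_le_one (fun P _ => by positivity) fun P _ => ?_⟩
  have h : (0 : ℝ) ≤ (Ideal.absNorm P : ℝ)⁻¹ := by positivity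
  exact inv_le_one_of_one_le₀ (by linarith)

/-- **Injectivity of `(R, J) ↦ RJ`** on pairs with `R` `z`-rough and `J` of norm `< z` (both nonzero):
`RJ = R'J'` forces `R ∣ R'` and `R' ∣ R` by coprimality, so `R = R'`, and then `J = J'` by
cancellation. [cite: HeathBrownActa2001, §10 p. 62] -/
theorem mul_injOn_rough_small {z : ℝ} {R R' J J' : Ideal (𝓞 K)} (hR : IsRough z R) (hR' : IsRough z R')
    (hR0 : R ≠ ⊥) (hJ0 : J ≠ ⊥) (hJ'0 : J' ≠ ⊥) (hJ : (Ideal.absNorm J : ℝ) < z)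
    (hJ' : (Ideal.absNorm J' : ℝ) < z) (h : R * J = R' * J') : R = R' ∧ J = J' := by
  have hc1 : IsCoprime R J' := isCoprime_of_isRough_of_absNorm_lt hR hJ'0 hJ'
  have hc2 : IsCoprime R' J := isCoprime_of_isRough_of_absNorm_lt hR' hJ0 hJ
  have hd1 : R ∣ R' := hc1.dvd_of_dvd_mul_right ⟨J, by rw [← h, mul_comm]⟩
  have hd2 : R' ∣ R := hc2.dvd_of_dvd_mul_right ⟨J', by rw [h, mul_comm]⟩
  have hRR : R = R' :=
    le_antisymm (Ideal.le_of_dvd hd2) (Ideal.le_of_dvd hd1)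
  subst hRR
  have hR00 : (R : Ideal (𝓞 K)) ≠ 0 := by rwa [Ne, Ideal.zero_eq_bot]
  exact ⟨rfl, mul_left_cancel₀ hR00 h⟩

end LemmaThreeOne


/-! ### Lemma 3.2 applied to the pair sums `∑_{R,J} α_R β_J #𝒜^(K)_{RJ}` -/

section PairSums

variable {X η z L Rmax A B : ℝ}

open scoped Classical in
/-- **The core estimate.** Let `α` be supported on `z`-rough ideals `R` of square-free norm `≤ R_max`
with `|α| ≤ A`, and `β` on square-free ideals with `|β| ≤ B`; `J` runs over the ideals of norm `< L ≤ z`.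
Then, with `main(D) = 𝟙[N(D) ∈ 𝒯r]·X_𝒜ρ₂(D)/N(D)` (`X_𝒜 = 6η²X²/π²`),
`∑_{R,J} |α_R||β_J| |#𝒜^(K)_{RJ} − main(RJ)| ≤ AB ∑_{N(D) ≤ R_max L, N(D) ∈ 𝒯r} |#𝒜^(K)_D − X_𝒜ρ₂(D)/N(D)|`:
for `RJ ∉ 𝒯r` both `#𝒜^(K)_{RJ}` (Lemma 3.1) and `main(RJ)` vanish, and `(R, J) ↦ RJ` is injective
(p. 62: "Thus `R` and `J` are coprime, whence `RJ` may be assumed to be square-free. We also have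
`N(RJ) ≪ X^{2−τ/2}` … We are therefore in a position to apply Lemma 3.2").
[cite: HeathBrownActa2001, §10 pp. 61–62] -/
theorem sum_pairs_abs_sub_main_le (hX : 0 ≤ X) (hz : L ≤ z) (hRmax : 0 ≤ Rmax)
    (𝓡 : Finset (Ideal (𝓞 K))) (α β : Ideal (𝓞 K) → ℝ)
    (hα : ∀ R ∈ 𝓡, α R ≠ 0 →
      Squarefree (Ideal.absNorm R) ∧ IsRough z R ∧ (Ideal.absNorm R : ℝ) ≤ Rmax)
    (hαA : ∀ R ∈ 𝓡, |α R| ≤ A) (hβ : ∀ J, β J ≠ 0 → Squarefree J)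
    (hβB : ∀ J ∈ (idealsLE ⌊L⌋₊).filter (fun J => (Ideal.absNorm J : ℝ) < L), |β J| ≤ B)
    (hA : 0 ≤ A) (hB : 0 ≤ B) :
    ∑ R ∈ 𝓡, ∑ J ∈ (idealsLE ⌊L⌋₊).filter (fun J => (Ideal.absNorm J : ℝ) < L),
        |α R| * |β J| * |(countA X η (R * J) : ℝ) -
          (if Squarefree (Ideal.absNorm (R * J)) then
            sizeA X η * rho₂ (R * J) / Ideal.absNorm (R * J) else 0)| ≤
      A * B * ∑ D ∈ (idealsLE ⌊Rmax * L⌋₊).filter (fun D => Squarefree (Ideal.absNorm D)),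
        |(countA X η D : ℝ) - sizeA X η * rho₂ D / Ideal.absNorm D| := by
  set 𝓙 := (idealsLE ⌊L⌋₊).filter (fun J => (Ideal.absNorm J : ℝ) < L) with h𝓙
  set G : Ideal (𝓞 K) → ℝ := fun D =>
    if Squarefree (Ideal.absNorm D) then |(countA X η D : ℝ) - sizeA X η * rho₂ D / Ideal.absNorm D|
    else 0 with hG
  have hG0 : ∀ D, 0 ≤ G D := fun D => by
    simp only [hG]; split_ifs <;> [exact abs_nonneg _; exact le_rfl]
  set F : Ideal (𝓞 K) × Ideal (𝓞 K) → ℝ := fun RJ =>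
    |α RJ.1| * |β RJ.2| * |(countA X η (RJ.1 * RJ.2) : ℝ) -
      (if Squarefree (Ideal.absNorm (RJ.1 * RJ.2)) then
        sizeA X η * rho₂ (RJ.1 * RJ.2) / Ideal.absNorm (RJ.1 * RJ.2) else 0)| with hF
  set P := (𝓡 ×ˢ 𝓙).filter (fun RJ => α RJ.1 ≠ 0 ∧ β RJ.2 ≠ 0) with hP
  -- properties of the pairs in `P`
  have hPprop : ∀ RJ ∈ P, Squarefree (Ideal.absNorm RJ.1) ∧ IsRough z RJ.1 ∧
      (Ideal.absNorm RJ.1 : ℝ) ≤ Rmax ∧ Squarefree RJ.2 ∧ (Ideal.absNorm RJ.2 : ℝ) < L ∧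
      RJ.1 ≠ ⊥ ∧ RJ.2 ≠ ⊥ ∧ RJ.1 ∈ 𝓡 ∧ RJ.2 ∈ 𝓙 := by
    intro RJ hRJ
    rw [hP, mem_filter, mem_product] at hRJ
    obtain ⟨⟨hR, hJ⟩, hαR, hβJ⟩ := hRJ
    have hJL : (Ideal.absNorm RJ.2 : ℝ) < L := by
      rw [h𝓙, mem_filter] at hJ; exact hJ.2
    obtain ⟨hsq, hrough, hRm⟩ := hα RJ.1 hR hαR
    have hJsq := hβ RJ.2 hβJ
    refine ⟨hsq, hrough, hRm, hJsq, hJL, ?_, ?_, hR, hJ⟩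
    · intro h; rw [h, Ideal.absNorm_bot] at hsq; exact not_squarefree_zero hsq
    · rw [Ne, ← Ideal.zero_eq_bot]; exact hJsq.ne_zero
  -- Step 1: restrict to `P` and bound termwise by `A B G(RJ)`
  have h1 : ∑ R ∈ 𝓡, ∑ J ∈ 𝓙, F (R, J) ≤ ∑ RJ ∈ P, A * B * G (RJ.1 * RJ.2) := by
    rw [← Finset.sum_product']   -- ∑_{RJ ∈ 𝓡 ×ˢ 𝓙} F RJ
    have hvan : ∀ RJ ∈ 𝓡 ×ˢ 𝓙, F RJ ≠ 0 → α RJ.1 ≠ 0 ∧ β RJ.2 ≠ 0 := by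
      intro RJ _ hF0
      constructor
      · intro h; apply hF0; simp only [hF, h, abs_zero, zero_mul]
      · intro h; apply hF0; simp only [hF, h, abs_zero, mul_zero, zero_mul]
    rw [← Finset.sum_filter_of_ne hvan]
    refine Finset.sum_le_sum fun RJ hRJ => ?_
    obtain ⟨hsq, hrough, hRm, hJsq, hJL, hR0, hJ0, hRmem, hJmem⟩ := hPprop RJ hRJ
    have hαle := hαA RJ.1 hRmem
    have hβle := hβB RJ.2 hJmem
    simp only [hF, hG]
    by_cases hsqf : Squarefree (Ideal.absNorm (RJ.1 * RJ.2))
    · rw [if_pos hsqf, if_pos hsqf]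
      exact mul_le_mul_of_nonneg_right (mul_le_mul hαle hβle (abs_nonneg _) hA) (abs_nonneg _)
    · rw [if_neg hsqf, if_neg hsqf, mul_zero]
      have hsqRJ : Squarefree (RJ.1 * RJ.2) :=
        squarefree_mul_of_rough_of_small hsq hrough hJsq (hJL.trans_le hz)
      rw [countA_eq_zero_of_not_squarefree_absNorm hX hsqRJ hsqf]
      simp
  -- Step 2: `(R, J) ↦ RJ` is injective on `P`, with image inside `N(D) ≤ R_max L`
  have hinj : Set.InjOn (fun RJ : Ideal (𝓞 K) × Ideal (𝓞 K) => RJ.1 * RJ.2) P := by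
    rintro ⟨R, J⟩ hRJ ⟨R', J'⟩ hRJ' h
    obtain ⟨-, hrough, -, -, hJL, hR0, hJ0, -, -⟩ := hPprop _ hRJ
    obtain ⟨-, hrough', -, -, hJL', -, hJ'0, -, -⟩ := hPprop _ hRJ'
    obtain ⟨h1, h2⟩ := mul_injOn_rough_small hrough hrough' hR0 hJ0 hJ'0 (hJL.trans_le hz)
      (hJL'.trans_le hz) h
    simp only at h1 h2
    rw [h1, h2]
  have himg : P.image (fun RJ : Ideal (𝓞 K) × Ideal (𝓞 K) => RJ.1 * RJ.2) ⊆ idealsLE ⌊Rmax * L⌋₊ := by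
    intro D hD
    obtain ⟨RJ, hRJ, rfl⟩ := Finset.mem_image.mp hD
    obtain ⟨-, -, hRm, -, hJL, -, -, -, -⟩ := hPprop RJ hRJ
    rw [mem_idealsLE]
    refine Nat.le_floor ?_
    rw [map_mul, Nat.cast_mul]
    exact mul_le_mul hRm hJL.le (Nat.cast_nonneg _) hRmax
  have h2 : ∑ RJ ∈ P, A * B * G (RJ.1 * RJ.2) ≤
      A * B * ∑ D ∈ idealsLE ⌊Rmax * L⌋₊, G D := by
    rw [← Finset.mul_sum, ← Finset.sum_image hinj]
    exact mul_le_mul_of_nonneg_left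
      (Finset.sum_le_sum_of_subset_of_nonneg himg fun D _ _ => hG0 D) (mul_nonneg hA hB)
  have h3 : ∑ D ∈ idealsLE ⌊Rmax * L⌋₊, G D =
      ∑ D ∈ (idealsLE ⌊Rmax * L⌋₊).filter (fun D => Squarefree (Ideal.absNorm D)),
        |(countA X η D : ℝ) - sizeA X η * rho₂ D / Ideal.absNorm D| := by
    rw [Finset.sum_filter]
  calc ∑ R ∈ 𝓡, ∑ J ∈ 𝓙, F (R, J) ≤ ∑ RJ ∈ P, A * B * G (RJ.1 * RJ.2) := h1
    _ ≤ A * B * ∑ D ∈ idealsLE ⌊Rmax * L⌋₊, G D := h2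
    _ = _ := by rw [h3]

open scoped Classical in
/-- **The main terms multiply**: on the support of `α ⊗ β` (as above), `N(RJ) ∈ 𝒯r ⟺ N(J) ∈ 𝒯r`,
`ρ₂(RJ) = ρ₂(R)ρ₂(J)` and `N(RJ) = N(R)N(J)`, so
`∑_{R,J} α_R β_J main(RJ) = X_𝒜 (∑_R α_R ρ₂(R)/N(R)) (∑_{J ∈ 𝒯r} β_J ρ₂(J)/N(J))` — the factorisation
"`(6η²X²/π²)∑_{R,J: RJ ∈ 𝒯r} c_{R,J}ρ₂(RJ)/N(RJ) = (6η²X²/π²)∑_R (…)ρ₂(R)N(R)^{-1} Σ₁`" of p. 62.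
[cite: HeathBrownActa2001, §10 p. 62] -/
theorem sum_pairs_main_eq (hz : L ≤ z) (𝓡 : Finset (Ideal (𝓞 K))) (α β : Ideal (𝓞 K) → ℝ)
    (hα : ∀ R ∈ 𝓡, α R ≠ 0 → Squarefree (Ideal.absNorm R) ∧ IsRough z R)
    (hβ : ∀ J, β J ≠ 0 → Squarefree J) :
    ∑ R ∈ 𝓡, ∑ J ∈ (idealsLE ⌊L⌋₊).filter (fun J => (Ideal.absNorm J : ℝ) < L),
        α R * β J * (if Squarefree (Ideal.absNorm (R * J)) then
          sizeA X η * rho₂ (R * J) / Ideal.absNorm (R * J) else 0) =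
      sizeA X η * (∑ R ∈ 𝓡, α R * (rho₂ R / Ideal.absNorm R)) *
        ∑ J ∈ ((idealsLE ⌊L⌋₊).filter (fun J => (Ideal.absNorm J : ℝ) < L)).filter
          (fun J => Squarefree (Ideal.absNorm J)), β J * (rho₂ J / Ideal.absNorm J) := by
  rw [Finset.sum_filter, mul_assoc, Finset.sum_mul_sum, Finset.mul_sum]
  refine Finset.sum_congr rfl fun R hR => ?_
  rw [Finset.mul_sum]
  refine Finset.sum_congr rfl fun J hJ => ?_
  rw [mem_filter] at hJ
  obtain ⟨-, hJL⟩ := hJ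
  by_cases hαR : α R = 0
  · simp [hαR]
  by_cases hβJ : β J = 0
  · simp [hβJ]
  obtain ⟨hsq, hrough⟩ := hα R hR hαR
  have hJsq := hβ J hβJ
  have hiff := squarefree_absNorm_mul_iff hsq hrough (hJL.trans_le hz) (J := J)
  by_cases hJn : Squarefree (Ideal.absNorm J)
  · rw [if_pos (hiff.mpr hJn), if_pos hJn]
    have hR0 : R ≠ ⊥ := fun h => by rw [h, Ideal.absNorm_bot] at hsq; exact not_squarefree_zero hsq
    have hJ0 : J ≠ ⊥ := fun h => by rw [h, Ideal.absNorm_bot] at hJn; exact not_squarefree_zero hJn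
    have hcop := isCoprime_of_isRough_of_absNorm_lt hrough hJ0 (hJL.trans_le hz)
    rw [rho₂_mul_of_coprime hR0 hJ0 hcop, map_mul, Nat.cast_mul]
    have hNR : (Ideal.absNorm R : ℝ) ≠ 0 := by exact_mod_cast (Squarefree.ne_zero hsq)
    have hNJ : (Ideal.absNorm J : ℝ) ≠ 0 := by exact_mod_cast (Squarefree.ne_zero hJn)
    field_simp
  · rw [if_neg (fun h => hJn (hiff.mp h)), if_neg hJn]
    simp

open scoped Classical in
/-- **Lemma 3.2 for signed pair sums** (the step `U_e(𝒜) = (6η²X²/π²)∑ c_{R,J}ρ₂(RJ)/N(RJ) + O(…)` of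
p. 62): under the support conditions of `sum_pairs_abs_sub_main_le`,
`|∑_{R,J} α_Rβ_J #𝒜^(K)_{RJ} − X_𝒜(∑_R α_Rρ₂(R)/N(R))(∑_{J∈𝒯r} β_Jρ₂(J)/N(J))| ≤ AB·∑_{N(D) ≤ R_maxL, D ∈ 𝒯r}|#𝒜^(K)_D − X_𝒜ρ₂(D)/N(D)|`.
[cite: HeathBrownActa2001, §10 p. 62] -/
theorem abs_sum_pairs_countA_sub_le (hX : 0 ≤ X) (hz : L ≤ z) (hRmax : 0 ≤ Rmax)
    (𝓡 : Finset (Ideal (𝓞 K))) (α β : Ideal (𝓞 K) → ℝ)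
    (hα : ∀ R ∈ 𝓡, α R ≠ 0 →
      Squarefree (Ideal.absNorm R) ∧ IsRough z R ∧ (Ideal.absNorm R : ℝ) ≤ Rmax)
    (hαA : ∀ R ∈ 𝓡, |α R| ≤ A) (hβ : ∀ J, β J ≠ 0 → Squarefree J)
    (hβB : ∀ J ∈ (idealsLE ⌊L⌋₊).filter (fun J => (Ideal.absNorm J : ℝ) < L), |β J| ≤ B)
    (hA : 0 ≤ A) (hB : 0 ≤ B) :
    |∑ R ∈ 𝓡, ∑ J ∈ (idealsLE ⌊L⌋₊).filter (fun J => (Ideal.absNorm J : ℝ) < L),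
        α R * β J * (countA X η (R * J) : ℝ) -
      sizeA X η * (∑ R ∈ 𝓡, α R * (rho₂ R / Ideal.absNorm R)) *
        ∑ J ∈ ((idealsLE ⌊L⌋₊).filter (fun J => (Ideal.absNorm J : ℝ) < L)).filter
          (fun J => Squarefree (Ideal.absNorm J)), β J * (rho₂ J / Ideal.absNorm J)| ≤
      A * B * ∑ D ∈ (idealsLE ⌊Rmax * L⌋₊).filter (fun D => Squarefree (Ideal.absNorm D)),
        |(countA X η D : ℝ) - sizeA X η * rho₂ D / Ideal.absNorm D| := by
  rw [← sum_pairs_main_eq hz 𝓡 α β (fun R hR h => ⟨(hα R hR h).1, (hα R hR h).2.1⟩) hβ]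
  refine le_trans ?_ (sum_pairs_abs_sub_main_le hX hz hRmax 𝓡 α β hα hαA hβ hβB hA hB)
  rw [← Finset.sum_sub_distrib]
  refine (Finset.abs_sum_le_sum_abs _ _).trans (Finset.sum_le_sum fun R _ => ?_)
  rw [← Finset.sum_sub_distrib]
  refine (Finset.abs_sum_le_sum_abs _ _).trans (Finset.sum_le_sum fun J _ => ?_)
  rw [← mul_sub, abs_mul, abs_mul]

open scoped Classical in
/-- **Lemma 3.2 as an upper bound for non-negative pair sums** (the shape used for the error terms
(10.1)–(10.2), p. 61: "`∑_{R,J} c_R μ(J)² #𝒜^(K)_{RJ} ≪ (6η²X²/π²)∑_{R,J} N(RJ)^{-1} + X^{2−τ/4}(log X)^c`"):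
for `α, β ≥ 0` as above,
`∑_{R,J} α_Rβ_J #𝒜^(K)_{RJ} ≤ X_𝒜(∑_R α_R/N(R))(∑_J β_J/N(J)) + AB·∑_{N(D)≤R_maxL, D∈𝒯r}|#𝒜^(K)_D − X_𝒜ρ₂(D)/N(D)|`.
[cite: HeathBrownActa2001, §10 (10.2)] -/
theorem sum_pairs_countA_le (hX : 0 ≤ X) (hz : L ≤ z) (hRmax : 0 ≤ Rmax)
    (𝓡 : Finset (Ideal (𝓞 K))) (α β : Ideal (𝓞 K) → ℝ)
    (hα : ∀ R ∈ 𝓡, α R ≠ 0 →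
      Squarefree (Ideal.absNorm R) ∧ IsRough z R ∧ (Ideal.absNorm R : ℝ) ≤ Rmax)
    (hαA : ∀ R ∈ 𝓡, |α R| ≤ A) (hβ : ∀ J, β J ≠ 0 → Squarefree J)
    (hβB : ∀ J ∈ (idealsLE ⌊L⌋₊).filter (fun J => (Ideal.absNorm J : ℝ) < L), |β J| ≤ B)
    (hA : 0 ≤ A) (hB : 0 ≤ B) (hα0 : ∀ R, 0 ≤ α R) (hβ0 : ∀ J, 0 ≤ β J) :
    ∑ R ∈ 𝓡, ∑ J ∈ (idealsLE ⌊L⌋₊).filter (fun J => (Ideal.absNorm J : ℝ) < L),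
        α R * β J * (countA X η (R * J) : ℝ) ≤
      sizeA X η * (∑ R ∈ 𝓡, α R / Ideal.absNorm R) *
          (∑ J ∈ (idealsLE ⌊L⌋₊).filter (fun J => (Ideal.absNorm J : ℝ) < L), β J / Ideal.absNorm J) +
        A * B * ∑ D ∈ (idealsLE ⌊Rmax * L⌋₊).filter (fun D => Squarefree (Ideal.absNorm D)),
          |(countA X η D : ℝ) - sizeA X η * rho₂ D / Ideal.absNorm D| := by
  set 𝓙 := (idealsLE ⌊L⌋₊).filter (fun J => (Ideal.absNorm J : ℝ) < L) with h𝓙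
  have hcore := sum_pairs_abs_sub_main_le (η := η) hX hz hRmax 𝓡 α β hα hαA hβ hβB hA hB
  have hsA : 0 ≤ sizeA X η := sizeA_nonneg X η
  set mainT : Ideal (𝓞 K) → Ideal (𝓞 K) → ℝ := fun R J =>
    if Squarefree (Ideal.absNorm (R * J)) then sizeA X η * rho₂ (R * J) / Ideal.absNorm (R * J) else 0
    with hmainT
  -- `main(RJ) ≤ X_𝒜/(N(R)N(J))`
  have hmain_le : ∀ R J, mainT R J ≤ sizeA X η / ((Ideal.absNorm R : ℝ) * Ideal.absNorm J) := by
    intro R J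
    simp only [hmainT]
    rw [← Nat.cast_mul, ← map_mul]
    split_ifs with h
    · have hN : (0 : ℝ) < Ideal.absNorm (R * J) := by exact_mod_cast Nat.pos_of_ne_zero (Squarefree.ne_zero h)
      rw [mul_div_assoc]
      calc sizeA X η * (rho₂ (R * J) / Ideal.absNorm (R * J)) ≤ sizeA X η * (1 / Ideal.absNorm (R * J)) := by
            gcongr; exact (rho₂_nonneg_le_one _).2
        _ = sizeA X η / Ideal.absNorm (R * J) := by ring
    · positivity
  -- split `#𝒜 = main + (#𝒜 − main)`
  have hsplit : ∀ R J, α R * β J * (countA X η (R * J) : ℝ) =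
      α R * β J * mainT R J + α R * β J * ((countA X η (R * J) : ℝ) - mainT R J) := fun R J => by ring
  simp_rw [hsplit, Finset.sum_add_distrib]
  refine add_le_add ?_ ?_
  · calc ∑ R ∈ 𝓡, ∑ J ∈ 𝓙, α R * β J * mainT R J
        ≤ ∑ R ∈ 𝓡, ∑ J ∈ 𝓙, α R * β J * (sizeA X η / ((Ideal.absNorm R : ℝ) * Ideal.absNorm J)) :=
          Finset.sum_le_sum fun R _ => Finset.sum_le_sum fun J _ =>
            mul_le_mul_of_nonneg_left (hmain_le R J) (mul_nonneg (hα0 R) (hβ0 J))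
      _ = sizeA X η * (∑ R ∈ 𝓡, α R / Ideal.absNorm R) * ∑ J ∈ 𝓙, β J / Ideal.absNorm J := by
          rw [mul_assoc, Finset.sum_mul_sum, Finset.mul_sum]
          refine Finset.sum_congr rfl fun R _ => ?_
          rw [Finset.mul_sum]
          refine Finset.sum_congr rfl fun J _ => ?_
          rw [div_mul_div_comm]
          ring
  · calc ∑ R ∈ 𝓡, ∑ J ∈ 𝓙, α R * β J * ((countA X η (R * J) : ℝ) - mainT R J)
        ≤ ∑ R ∈ 𝓡, ∑ J ∈ 𝓙, |α R| * |β J| * |(countA X η (R * J) : ℝ) - mainT R J| :=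
          Finset.sum_le_sum fun R _ => Finset.sum_le_sum fun J _ => by
            rw [← abs_mul, ← abs_mul]; exact le_abs_self _
      _ ≤ _ := hcore

end PairSums


/-! ### The total Type I error over the ideals of square-free norm `≤ B` (Lemma 3.2 summed, plus `R = 1`) -/

section TypeITotal

open scoped Classical in
/-- **Lemma 3.2 summed over all `D ∈ 𝒯r` with `N(D) ≤ B`** (from `HeathBrown2001_typeI_A_holds` through
`exists_typeI_dyadic`, plus the term `D = (1)`, `|#𝒜^(K) − X_𝒜| ≪ X log X`): there are `k`, `C ≥ 0` such
that for `X ≥ 3`, `η` in the range (2.1) and `1 ≤ B ≤ X³`,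
`∑_{N(D) ≤ B, D ∈ 𝒯r} |#𝒜^(K)_D − X_𝒜ρ₂(D)/N(D)| ≤ C (X(1 + log X) + (B + X√B + X^{3/2})(log X)^{k+1})`.
[cite: HeathBrownActa2001, Lemma 3.2] -/
theorem exists_typeI_squarefree_sum_le :
    ∃ (k : ℕ) (C : ℝ), 0 ≤ C ∧ ∀ X η B : ℝ, 3 ≤ X →
      Real.exp (-Real.log X ^ (1 / 3 : ℝ)) ≤ η → η ≤ 1 → 1 ≤ B → B ≤ X ^ 3 →
      ∑ D ∈ (idealsLE ⌊B⌋₊).filter (fun D => Squarefree (Ideal.absNorm D)),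
          |(countA X η D : ℝ) - sizeA X η * rho₂ D / Ideal.absNorm D| ≤
        C * (X * (1 + Real.log X) + (B + X * Real.sqrt B + X ^ (3 / 2 : ℝ)) * Real.log X ^ (k + 1)) := by
  obtain ⟨k, C₂, hC₂, h₂⟩ := exists_typeI_dyadic HeathBrown2001_typeI_A_holds
  obtain ⟨C₁, hC₁, h₁⟩ := exists_abs_countA_one_sub_sizeA_le
  refine ⟨k, max C₁ C₂, le_max_of_le_left hC₁.le, fun X η B hX hηlo hη1 hB1 hBX => ?_⟩
  have hη0 : 0 ≤ η := le_trans (Real.exp_pos _).le hηlo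
  have hX2 : 2 ≤ X := by linarith
  set S := (idealsLE ⌊B⌋₊).filter (fun D => Squarefree (Ideal.absNorm D)) with hS
  set f : Ideal (𝓞 K) → ℝ := fun D => |(countA X η D : ℝ) - sizeA X η * rho₂ D / Ideal.absNorm D| with hf
  rw [← Finset.sum_filter_add_sum_filter_not S (fun D => 2 ≤ Ideal.absNorm D)]
  -- the part `N(D) ≥ 2`
  have hbig : ∑ D ∈ S.filter (fun D => 2 ≤ Ideal.absNorm D), f D ≤
      C₂ * (B + X * Real.sqrt B + X ^ (3 / 2 : ℝ)) * Real.log X ^ (k + 1) := by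
    have hset : S.filter (fun D => 2 ≤ Ideal.absNorm D) =
        (idealsLE ⌊B⌋₊).filter (fun R => 2 ≤ Ideal.absNorm R ∧ Squarefree (Ideal.absNorm R)) := by
      rw [hS, Finset.filter_filter]
      exact Finset.filter_congr fun D _ => and_comm
    rw [hset]
    exact h₂ X η B hX hηlo hη1 hB1 hBX
  -- the part `N(D) < 2`, i.e. `D = (1)`
  have hsmall : ∑ D ∈ S.filter (fun D => ¬2 ≤ Ideal.absNorm D), f D ≤ C₁ * X * (1 + Real.log X) := by
    have hsub : S.filter (fun D => ¬2 ≤ Ideal.absNorm D) ⊆ {⊤} := by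
      intro D hD
      rw [mem_filter, hS, mem_filter] at hD
      rw [Finset.mem_singleton]
      have h0 : Ideal.absNorm D ≠ 0 := Squarefree.ne_zero hD.1.2
      have h1 : Ideal.absNorm D = 1 := by omega
      exact Ideal.absNorm_eq_one_iff.mp h1
    calc ∑ D ∈ S.filter (fun D => ¬2 ≤ Ideal.absNorm D), f D ≤ ∑ D ∈ ({⊤} : Finset (Ideal (𝓞 K))), f D :=
          Finset.sum_le_sum_of_subset_of_nonneg hsub fun D _ _ => abs_nonneg _
      _ = |(countA X η 1 : ℝ) - sizeA X η| := by
          rw [Finset.sum_singleton, hf]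
          simp only
          rw [countA_top_sub_eq, countA, APairs_one]
      _ ≤ C₁ * X * (1 + Real.log X) := h₁ X η hX2 hη0 hη1
  have hlog : 0 ≤ Real.log X := Real.log_nonneg (by linarith)
  have hT1 : 0 ≤ X * (1 + Real.log X) := by nlinarith
  have hT2 : 0 ≤ (B + X * Real.sqrt B + X ^ (3 / 2 : ℝ)) * Real.log X ^ (k + 1) := by positivity
  calc ∑ D ∈ S.filter (fun D => 2 ≤ Ideal.absNorm D), f D +
        ∑ D ∈ S.filter (fun D => ¬2 ≤ Ideal.absNorm D), f D
      ≤ C₂ * (B + X * Real.sqrt B + X ^ (3 / 2 : ℝ)) * Real.log X ^ (k + 1) + C₁ * X * (1 + Real.log X) :=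
        add_le_add hbig hsmall
    _ ≤ max C₁ C₂ * ((B + X * Real.sqrt B + X ^ (3 / 2 : ℝ)) * Real.log X ^ (k + 1)) +
        max C₁ C₂ * (X * (1 + Real.log X)) := by
        rw [mul_assoc, mul_assoc]
        exact add_le_add (mul_le_mul_of_nonneg_right (le_max_right _ _) hT2)
          (mul_le_mul_of_nonneg_right (le_max_left _ _) hT1)
    _ = max C₁ C₂ * (X * (1 + Real.log X) + (B + X * Real.sqrt B + X ^ (3 / 2 : ℝ)) * Real.log X ^ (k + 1)) := by
        ring

end TypeITotal

end Literature.NumberTheory.Sieve.CubicSieve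

end
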